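import Summits.Ventures.PercRepro.ProfileFlatUpsetLineSwap

/-!
# PercRepro — (G) AT THE PRINCIPAL UP-SET OF A THREE-POINT LINE ON `2r − 2` POINTS (every rank)
(p10, gen 20; `proofs/P10-AVFULL.md` §28(b), (h))

`M` of rank `r` on `N = 2r − 2` points, `F₀` a flat of rank `2` with exactly three points (a three-point line, or a
parallel pair with a third point), `U = principalUp M F₀`.  A separated set misses exactly one point of `F₀`
(`exists_unique_notMem_of_mem_sepSets`: `F₀ ⊆ Z` would make the three points independent, two points of `F₀` in
`E ∖ Z` would span `F₀`).  THE SWAP RELATION `E ∖ Z ⊆ B` between the negative and the positive sets: a negative `Z`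
missing `g ∈ F₀` lies below the sets `(E ∖ Z) ∪ c` for every `c ∈ F₀` not parallel to `g` (`parFree M F₀ g`;
`card_parFree_le_card_bipartiteAbove`), and a positive `B` missing `b ∈ F₀` lies above at most `#(parFree M F₀ b)`
negative sets (`card_bipartiteBelow_le_card_parFree`).  The count `#(parFree M F₀ x)` is the same for every point
`x` whose two partners are independent (`card_parFree_eq`: it is `1 + [x ∦ y]`, symmetric in `x, y`), so the double
counting `Finset.card_mul_le_card_mul` with `m = n = #(parFree M F₀ g₀)` gives `#neg ≤ #pos`
(`card_negTwo_le_card_posTwo_of_line_three`) and THEOREM `sum_sepSets_principal_nonneg_of_line_three`.  Census (own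
code, gen 20): `#neg = #pos` in all 434 instances with `rk F₀ = 2`, `#F₀ = 3` at `n = 8`.  A rank-`2` flat with four
or more points has no negative set (`negTwo_eq_empty_of_four_le_card`).
-/

open scoped Matroid

namespace PercRepro.Cogirth

open Finset ThmH Skew

variable {α : Type} [DecidableEq α] {M : Matroid α} [M.Finite]

/-! ### Points of `F₀` not parallel to a given point -/

/-- The points of `F₀` outside the closure of `{x}`. -/
noncomputable def parFree (M : Matroid α) [M.Finite] (F₀ : Finset α) (x : α) : Finset α :=
  F₀.filter (fun p => p ∉ clF M ({x} : Finset α))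

/-- Membership in `parFree`. -/
theorem mem_parFree {F₀ : Finset α} {x p : α} : p ∈ parFree M F₀ x ↔ p ∈ F₀ ∧ p ∉ clF M ({x} : Finset α) := by
  unfold parFree; rw [mem_filter]

/-- A rank-two flat lies in the closure of any two of its points that are independent. -/
theorem subset_clF_pair_of_rk_two {F₀ : Finset α} (hF : IsFlatF M F₀) (hrF : rk M F₀ = 2) {x y : α}
    (hx : x ∈ F₀) (hy : y ∈ F₀) (hxy : rk M ({x, y} : Finset α) = 2) : F₀ ⊆ clF M ({x, y} : Finset α) :=
  subset_clF_of_rk_le hF.1 (insert_subset hx (singleton_subset_iff.2 hy)) (by rw [hrF, hxy])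

/-- For a non-loop `x`, `y ∉ cl {x}` means `rk {x, y} = 2`. -/
theorem rk_pair_eq_two_of_notMem_clF {x y : α} (hx : x ∈ gr M) (hy : y ∈ gr M) (hx1 : rk M ({x} : Finset α) = 1)
    (h : y ∉ clF M ({x} : Finset α)) : rk M ({x, y} : Finset α) = 2 := by
  rw [mem_clF_iff_rk_insert_eq hy (singleton_subset_iff.2 hx)] at h
  have h1 := rk_insert_le (M := M) y {x}
  have h2 := rk_mono_fu (M := M) (subset_insert y ({x} : Finset α))
  rw [pair_comm]
  omega

/-- Parallelism is symmetric on non-loops: `y ∉ cl {x} ↔ x ∉ cl {y}`. -/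
theorem notMem_clF_singleton_comm {x y : α} (hx : x ∈ gr M) (hy : y ∈ gr M) (hx1 : rk M ({x} : Finset α) = 1)
    (hy1 : rk M ({y} : Finset α) = 1) : y ∉ clF M ({x} : Finset α) ↔ x ∉ clF M ({y} : Finset α) := by
  rw [mem_clF_iff_rk_insert_eq hy (singleton_subset_iff.2 hx), mem_clF_iff_rk_insert_eq hx
    (singleton_subset_iff.2 hy), hx1, hy1, pair_comm]

/-! ### A separated set misses exactly one point of a three-point rank-two flat -/

/-- A separated set of a three-point rank-two flat misses exactly one of its points. -/
theorem exists_unique_notMem_of_mem_sepSets {F₀ : Finset α} (hF : IsFlatF M F₀) (hrF : rk M F₀ = 2)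
    (hF₀c : F₀.card = 3) {Z : Finset α} (hZ : Z ∈ sepSets M (principalUp M F₀)) :
    ∃ g ∈ F₀, g ∉ Z ∧ ∀ y ∈ F₀, y ∉ Z → y = g := by
  obtain ⟨_, hout⟩ := subset_clF_of_mem_sepSets_principal hZ
  obtain ⟨hZg, hZr, hZcr⟩ := mem_biIndepAll.1 (mem_sepSets.1 hZ).1
  -- some point of `F₀` is outside `Z`
  have hex : ∃ g ∈ F₀, g ∉ Z := by
    by_contra hcon
    have hsub : F₀ ⊆ Z := fun y hy => by
      by_contra hyZ; exact hcon ⟨y, hy, hyZ⟩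
    have := rk_eq_card_of_subset_of_rk_eq_card hsub hZr
    omega
  obtain ⟨g, hgF, hgZ⟩ := hex
  refine ⟨g, hgF, hgZ, ?_⟩
  intro y hyF hyZ
  by_contra hne
  -- two points of `F₀` outside `Z` span `F₀` inside `cl (E ∖ Z)`
  have hpair : ({g, y} : Finset α) ⊆ gr M \ Z :=
    insert_subset (mem_sdiff.2 ⟨hF.1 hgF, hgZ⟩) (singleton_subset_iff.2 (mem_sdiff.2 ⟨hF.1 hyF, hyZ⟩))
  have hr2 : rk M ({g, y} : Finset α) = 2 := by
    rw [rk_eq_card_of_subset_of_rk_eq_card hpair hZcr, card_pair (Ne.symm hne)]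
  apply hout
  exact (subset_clF_pair_of_rk_two hF hrF hgF hyF hr2).trans (clF_mono_fu hpair)

/-- The two partners of the missed point are independent: `rk (F₀ ∖ g) = 2`. -/
theorem rk_erase_eq_two_of_mem_sepSets {F₀ : Finset α} (hF₀c : F₀.card = 3) {Z : Finset α}
    (hZ : Z ∈ sepSets M (principalUp M F₀)) {g : α} (hgF : g ∈ F₀)
    (hg : ∀ y ∈ F₀, y ∉ Z → y = g) : rk M (F₀.erase g) = 2 := by
  obtain ⟨_, hZr, _⟩ := mem_biIndepAll.1 (mem_sepSets.1 hZ).1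
  have hsub : F₀.erase g ⊆ Z := by
    intro y hy
    rw [mem_erase] at hy
    by_contra hyZ
    exact hy.1 (hg y hy.2 hyZ)
  rw [rk_eq_card_of_subset_of_rk_eq_card hsub hZr, card_erase_of_mem hgF, hF₀c]

/-- Inside `F₀`, the closure of `E ∖ Z` is the closure of the missed point `g`. -/
theorem mem_clF_sdiff_iff_of_mem_sepSets {F₀ : Finset α} (hF : IsFlatF M F₀) (hrF : rk M F₀ = 2) {Z : Finset α}
    (hZ : Z ∈ sepSets M (principalUp M F₀)) {g : α} (hgF : g ∈ F₀) (hgZ : g ∉ Z) {c : α} (hcF : c ∈ F₀) :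
    c ∈ clF M (gr M \ Z) ↔ c ∈ clF M ({g} : Finset α) := by
  obtain ⟨_, hout⟩ := subset_clF_of_mem_sepSets_principal hZ
  obtain ⟨_, _, hZcr⟩ := mem_biIndepAll.1 (mem_sepSets.1 hZ).1
  have hgg : g ∈ gr M \ Z := mem_sdiff.2 ⟨hF.1 hgF, hgZ⟩
  have hg1 : rk M ({g} : Finset α) = 1 := by
    rw [rk_eq_card_of_subset_of_rk_eq_card (singleton_subset_iff.2 hgg) hZcr, card_singleton]
  constructor
  · intro hc
    by_contra hcon
    have hr2 := rk_pair_eq_two_of_notMem_clF (hF.1 hgF) (hF.1 hcF) hg1 hcon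
    apply hout
    refine (subset_clF_pair_of_rk_two hF hrF hgF hcF hr2).trans (clF_subset_of_isFlatF (isFlatF_clF _) ?_)
    exact insert_subset (subset_clF_fu sdiff_subset hgg) (singleton_subset_iff.2 hc)
  · exact fun hc => clF_mono_fu (singleton_subset_iff.2 hgg) hc

/-! ### The degrees of the swap relation `E ∖ Z ⊆ B` -/

/-- A negative set missing `g` lies below at least `#(parFree M F₀ g)` positive sets. -/
theorem card_parFree_le_card_bipartiteAbove {F₀ : Finset α} (hF : IsFlatF M F₀)
    (hN : (gr M).card + 2 = 2 * rk M (gr M)) (hrF : rk M F₀ = 2) {Z : Finset α} (hZ : Z ∈ negTwo M F₀) {g : α}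
    (hgF : g ∈ F₀) (hgZ : g ∉ Z) (hg : ∀ y ∈ F₀, y ∉ Z → y = g) :
    (parFree M F₀ g).card ≤
      ((posTwo M F₀).bipartiteAbove (fun (Z B : Finset α) => gr M \ Z ⊆ B) Z).card := by
  have hZs : Z ∈ sepSets M (principalUp M F₀) := (mem_negTwo.1 hZ).1
  apply card_le_card_of_injOn (fun c => insert c (gr M \ Z))
  · intro c hc
    rw [mem_coe, mem_parFree] at hc
    have hcg : c ≠ g := fun h => hc.2 (h ▸ subset_clF_fu (singleton_subset_iff.2 (hF.1 hgF)) (mem_singleton_self g))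
    have hcZ : c ∈ Z := by
      by_contra hcZ; exact hcg (hg c hc.1 hcZ)
    have hccl : c ∉ clF M (gr M \ Z) := fun h =>
      hc.2 ((mem_clF_sdiff_iff_of_mem_sepSets hF hrF hZs hgF hgZ hc.1).1 h)
    rw [mem_coe, mem_bipartiteAbove]
    exact ⟨insert_sdiff_mem_posTwo hF hN hc.1 hZ hcZ hccl, subset_insert _ _⟩
  · intro c₁ hc₁ c₂ hc₂ heq
    rw [mem_coe, mem_parFree] at hc₁ hc₂
    have hcg : ∀ c, c ∈ F₀ → c ∉ clF M ({g} : Finset α) → c ∉ gr M \ Z := by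
      intro c hcF hccl hcs
      rw [mem_sdiff] at hcs
      exact hccl ((hg c hcF hcs.2) ▸ subset_clF_fu (singleton_subset_iff.2 (hF.1 hgF)) (mem_singleton_self g))
    have heq' : insert c₁ (gr M \ Z) = insert c₂ (gr M \ Z) := heq
    have h1 : c₁ ∈ insert c₂ (gr M \ Z) := by rw [← heq']; exact mem_insert_self _ _
    rw [mem_insert] at h1
    rcases h1 with h | h
    · exact h
    · exact absurd h (hcg c₁ hc₁.1 hc₁.2)

/-- A positive set missing `b` lies above at most `#(parFree M F₀ b)` negative sets. -/
theorem card_bipartiteBelow_le_card_parFree {F₀ : Finset α} (hF : IsFlatF M F₀)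
    (hN : (gr M).card + 2 = 2 * rk M (gr M)) (hrF : rk M F₀ = 2) (hF₀c : F₀.card = 3) {B : Finset α}
    (hB : B ∈ posTwo M F₀) {b : α} (hbF : b ∈ F₀) (hbB : b ∉ B) :
    ((negTwo M F₀).bipartiteBelow (fun (Z B : Finset α) => gr M \ Z ⊆ B) B).card ≤ (parFree M F₀ b).card := by
  obtain ⟨hBs, hBc⟩ := mem_posTwo.1 hB
  obtain ⟨hBg, hBr, _⟩ := mem_biIndepAll.1 (mem_sepSets.1 hBs).1
  have hsub : (negTwo M F₀).bipartiteBelow (fun (Z B : Finset α) => gr M \ Z ⊆ B) B ⊆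
      (parFree M F₀ b).image (fun c => gr M \ B.erase c) := by
    intro Z hZ
    rw [mem_bipartiteBelow] at hZ
    obtain ⟨hZn, hZB⟩ := hZ
    obtain ⟨hZs, hZc⟩ := mem_negTwo.1 hZn
    obtain ⟨hZg, hZr, _⟩ := mem_biIndepAll.1 (mem_sepSets.1 hZs).1
    obtain ⟨_, hout⟩ := subset_clF_of_mem_sepSets_principal hZs
    obtain ⟨_, _, hsum⟩ := bounds_of_mem_sepSets_principal hF hZs
    -- `B ∖ (E ∖ Z) = {c}`
    have hone : (B \ (gr M \ Z)).card = 1 := by rw [card_sdiff_of_subset hZB]; omega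
    obtain ⟨c, hc⟩ := card_eq_one.1 hone
    have hcmem : c ∈ B \ (gr M \ Z) := by rw [hc]; exact mem_singleton_self c
    rw [mem_sdiff, mem_sdiff, not_and, not_not] at hcmem
    have hcZ : c ∈ Z := hcmem.2 (hBg hcmem.1)
    have hBeq : B = insert c (gr M \ Z) := by rw [insert_eq, ← hc, sdiff_union_of_subset hZB]
    have hZeq : gr M \ B.erase c = Z := by
      rw [hBeq, erase_insert (fun h => (mem_sdiff.1 h).2 hcZ), Finset.sdiff_sdiff_eq_self hZg]
    rw [mem_image]
    refine ⟨c, ?_, hZeq⟩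
    rw [mem_parFree]
    -- `b ∈ Z ∖ c`
    have hbZ : b ∈ Z := by
      by_contra hbZ
      exact hbB (hZB (mem_sdiff.2 ⟨hF.1 hbF, hbZ⟩))
    have hbc : b ≠ c := fun h => hbB (h ▸ hcmem.1)
    -- `c ∈ F₀`: otherwise `F₀ ∖ g ⊆ E ∖ B` spans `F₀`
    have hcF : c ∈ F₀ := by
      by_contra hcF
      obtain ⟨g, hgF, hgZ, hg⟩ := exists_unique_notMem_of_mem_sepSets hF hrF hF₀c hZs
      have hr2 := rk_erase_eq_two_of_mem_sepSets hF₀c hZs hgF hg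
      have hsub' : F₀.erase g ⊆ gr M \ B := by
        intro y hy
        rw [mem_erase] at hy
        have hyZ : y ∈ Z := by
          by_contra hyZ; exact hy.1 (hg y hy.2 hyZ)
        rw [mem_sdiff, hBeq, mem_insert, mem_sdiff, not_or, not_and, not_not]
        exact ⟨hF.1 hy.2, fun h => hcF (h ▸ hy.2), fun _ => hyZ⟩
      have hspan : F₀ ⊆ clF M (F₀.erase g) := subset_clF_of_rk_le hF.1 (erase_subset g F₀) (by rw [hrF, hr2])
      exact (subset_clF_of_mem_sepSets_principal hBs).2 (hspan.trans (clF_mono_fu hsub'))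
    refine ⟨hcF, fun hccl => ?_⟩
    -- `c ∈ cl {b} ⊆ cl (Z ∖ c)` contradicts the independence of `Z`
    have h1 : c ∈ clF M (Z.erase c) :=
      clF_mono_fu (singleton_subset_iff.2 (mem_erase.2 ⟨hbc, hbZ⟩)) hccl
    exact notMem_clF_erase_of_rk_eq_card (hZg hcZ) hZg hZr hcZ h1
  exact (card_le_card hsub).trans card_image_le

/-! ### The count `#(parFree M F₀ x)` does not depend on the admissible point `x` -/

/-- `#(parFree M F₀ x)` is `1 + [x ∦ y]` for two points `x ≠ y` of `F₀` whose partners are independent; it is the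
same for `x` and `y`. -/
theorem card_parFree_eq {F₀ : Finset α} (hF : IsFlatF M F₀) (hF₀c : F₀.card = 3) {x y : α}
    (hx : x ∈ F₀) (hy : y ∈ F₀) (hx' : rk M (F₀.erase x) = 2) (hy' : rk M (F₀.erase y) = 2) :
    (parFree M F₀ x).card = (parFree M F₀ y).card := by
  by_cases hxy : x = y
  · rw [hxy]
  -- the third point `z`
  have hpair : ({x, y} : Finset α) ⊆ F₀ := insert_subset hx (singleton_subset_iff.2 hy)
  have hone : (F₀ \ {x, y}).card = 1 := by rw [card_sdiff_of_subset hpair, hF₀c, card_pair hxy]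
  obtain ⟨z, hz⟩ := card_eq_one.1 hone
  have hzmem : z ∈ F₀ \ {x, y} := by rw [hz]; exact mem_singleton_self z
  rw [mem_sdiff, mem_insert, mem_singleton, not_or] at hzmem
  have hF₀eq : F₀ = insert z (insert x {y}) := by rw [insert_eq, ← hz, sdiff_union_of_subset hpair]
  have hxg : x ∈ gr M := hF.1 hx
  have hyg : y ∈ gr M := hF.1 hy
  have hzg : z ∈ gr M := hF.1 hzmem.1
  -- `rk {y, z} = 2` and `rk {x, z} = 2`
  have hyz : rk M ({y, z} : Finset α) = 2 := by
    have : ({y, z} : Finset α) = F₀.erase x :=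
      eq_of_subset_of_card_le (insert_subset (mem_erase.2 ⟨Ne.symm hxy, hy⟩)
        (singleton_subset_iff.2 (mem_erase.2 ⟨hzmem.2.1, hzmem.1⟩)))
        (by rw [card_erase_of_mem hx, hF₀c, card_pair (Ne.symm hzmem.2.2)])
    rw [this, hx']
  have hxz : rk M ({x, z} : Finset α) = 2 := by
    have : ({x, z} : Finset α) = F₀.erase y :=
      eq_of_subset_of_card_le (insert_subset (mem_erase.2 ⟨hxy, hx⟩)
        (singleton_subset_iff.2 (mem_erase.2 ⟨hzmem.2.2, hzmem.1⟩)))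
        (by rw [card_erase_of_mem hy, hF₀c, card_pair (Ne.symm hzmem.2.1)])
    rw [this, hy']
  have hx1 : rk M ({x} : Finset α) = 1 := by
    have h5 := rk_insert_le (M := M) z {x}
    rw [pair_comm, hxz] at h5
    have h2 := rk_le_card (M := M) ({x} : Finset α)
    rw [card_singleton] at h2
    omega
  have hy1 : rk M ({y} : Finset α) = 1 := by
    have h5 := rk_insert_le (M := M) z {y}
    rw [pair_comm, hyz] at h5
    have h2 := rk_le_card (M := M) ({y} : Finset α)
    rw [card_singleton] at h2
    omega
  have hzx : z ∉ clF M ({x} : Finset α) := by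
    rw [mem_clF_iff_rk_insert_eq hzg (singleton_subset_iff.2 hxg), hx1, pair_comm, hxz]; omega
  have hzy : z ∉ clF M ({y} : Finset α) := by
    rw [mem_clF_iff_rk_insert_eq hzg (singleton_subset_iff.2 hyg), hy1, pair_comm, hyz]; omega
  have hxx : x ∈ clF M ({x} : Finset α) := subset_clF_fu (singleton_subset_iff.2 hxg) (mem_singleton_self x)
  have hyy : y ∈ clF M ({y} : Finset α) := subset_clF_fu (singleton_subset_iff.2 hyg) (mem_singleton_self y)
  have hsymm := notMem_clF_singleton_comm hxg hyg hx1 hy1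
  have hzn : z ∉ insert x ({y} : Finset α) := by
    rw [mem_insert, mem_singleton, not_or]; exact ⟨hzmem.2.1, hzmem.2.2⟩
  have hxn : x ∉ ({y} : Finset α) := by rw [mem_singleton]; exact hxy
  unfold parFree
  rw [hF₀eq, card_filter, card_filter, sum_insert hzn, sum_insert hxn, sum_singleton, sum_insert hzn,
    sum_insert hxn, sum_singleton, if_pos hzx, if_pos hzy, if_neg (not_not.2 hxx), if_neg (not_not.2 hyy)]
  by_cases hyx : y ∉ clF M ({x} : Finset α)
  · rw [if_pos hyx, if_pos (hsymm.1 hyx)]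
  · rw [if_neg hyx, if_neg (fun h => hyx (hsymm.2 h))]

/-- `parFree M F₀ g` is non-empty when the partners of `g` are independent. -/
theorem one_le_card_parFree {F₀ : Finset α} (hrF : rk M F₀ = 2) (g : α) : 1 ≤ (parFree M F₀ g).card := by
  rw [Nat.one_le_iff_ne_zero, Ne, card_eq_zero]
  intro hcon
  have hsub : F₀ ⊆ clF M ({g} : Finset α) := by
    intro p hp
    by_contra hpc
    have : p ∈ parFree M F₀ g := mem_parFree.2 ⟨hp, hpc⟩
    rw [hcon] at this
    exact notMem_empty p this
  have h1 := rk_mono_fu (M := M) hsub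
  rw [rk_clF_eq_fu, hrF] at h1
  have h2 := rk_le_card (M := M) ({g} : Finset α)
  rw [card_singleton] at h2
  omega

/-! ### The double counting -/

/-- **`#neg ≤ #pos` at a three-point rank-two flat on `2r − 2` points.** -/
theorem card_negTwo_le_card_posTwo_of_line_three {F₀ : Finset α} (hF : IsFlatF M F₀)
    (hN : (gr M).card + 2 = 2 * rk M (gr M)) (hrF : rk M F₀ = 2) (hF₀c : F₀.card = 3) :
    (negTwo M F₀).card ≤ (posTwo M F₀).card := by
  rcases (negTwo M F₀).eq_empty_or_nonempty with hne | ⟨Z₀, hZ₀⟩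
  · rw [hne, card_empty]; exact Nat.zero_le _
  obtain ⟨g₀, hg₀F, hg₀Z, hg₀⟩ := exists_unique_notMem_of_mem_sepSets hF hrF hF₀c (mem_negTwo.1 hZ₀).1
  have hg₀' := rk_erase_eq_two_of_mem_sepSets hF₀c (mem_negTwo.1 hZ₀).1 hg₀F hg₀
  have hd := one_le_card_parFree hrF g₀
  have h := card_mul_le_card_mul (fun (Z B : Finset α) => gr M \ Z ⊆ B) (s := negTwo M F₀) (t := posTwo M F₀)
    (m := (parFree M F₀ g₀).card) (n := (parFree M F₀ g₀).card)
    (fun Z hZ => by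
      obtain ⟨g, hgF, hgZ, hg⟩ := exists_unique_notMem_of_mem_sepSets hF hrF hF₀c (mem_negTwo.1 hZ).1
      have hg' := rk_erase_eq_two_of_mem_sepSets hF₀c (mem_negTwo.1 hZ).1 hgF hg
      rw [card_parFree_eq hF hF₀c hg₀F hgF hg₀' hg']
      exact card_parFree_le_card_bipartiteAbove hF hN hrF hZ hgF hgZ hg)
    (fun B hB => by
      obtain ⟨b, hbF, hbB, hb⟩ := exists_unique_notMem_of_mem_sepSets hF hrF hF₀c (mem_posTwo.1 hB).1
      have hb' := rk_erase_eq_two_of_mem_sepSets hF₀c (mem_posTwo.1 hB).1 hbF hb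
      rw [card_parFree_eq hF hF₀c hg₀F hbF hg₀' hb']
      exact card_bipartiteBelow_le_card_parFree hF hN hrF hF₀c hB hbF hbB)
  exact Nat.le_of_mul_le_mul_right h hd

/-- **(G) AT THE PRINCIPAL UP-SET OF A THREE-POINT RANK-TWO FLAT ON `2r − 2` POINTS**, every rank. -/
theorem sum_sepSets_principal_nonneg_of_line_three {F₀ : Finset α} (hF : IsFlatF M F₀)
    (hN : (gr M).card + 2 = 2 * rk M (gr M)) (hrF : rk M F₀ = 2) (hF₀c : F₀.card = 3) :
    0 ≤ ∑ Z ∈ sepSets M (principalUp M F₀), (2 * (Z.card : ℤ) - (gr M).card - 1) := by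
  rw [sum_term_eq_of_subset hF hN (Subset.refl _)]
  have hP : (sepSets M (principalUp M F₀)).filter (fun Z => Z ∈ posTwo M F₀) = posTwo M F₀ := by
    ext Z; rw [mem_filter]; exact ⟨fun h => h.2, fun h => ⟨(mem_posTwo.1 h).1, h⟩⟩
  have hN' : (sepSets M (principalUp M F₀)).filter (fun Z => Z ∈ negTwo M F₀) = negTwo M F₀ := by
    ext Z; rw [mem_filter]; exact ⟨fun h => h.2, fun h => ⟨(mem_negTwo.1 h).1, h⟩⟩
  rw [hP, hN']
  have := card_negTwo_le_card_posTwo_of_line_three hF hN hrF hF₀c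
  have h' : ((negTwo M F₀).card : ℤ) ≤ (posTwo M F₀).card := by exact_mod_cast this
  linarith

/-! ### Four or more points: no negative set -/

/-- A rank-two flat with at least four points has no separated set of size `r − 1` (indeed no separated set): a
separated `Z` would carry at most two points of `F₀` and `E ∖ Z` at most one. -/
theorem sepSets_eq_empty_of_four_le_card {F₀ : Finset α} (hF : IsFlatF M F₀) (hrF : rk M F₀ = 2)
    (hF₀c : 4 ≤ F₀.card) : sepSets M (principalUp M F₀) = ∅ := by
  rw [eq_empty_iff_forall_notMem]
  intro Z hZ
  obtain ⟨_, hout⟩ := subset_clF_of_mem_sepSets_principal hZ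
  obtain ⟨hZg, hZr, hZcr⟩ := mem_biIndepAll.1 (mem_sepSets.1 hZ).1
  -- `#(F₀ ∩ Z) ≤ 2`
  have h1 : (F₀ ∩ Z).card ≤ 2 := by
    have := rk_eq_card_of_subset_of_rk_eq_card (inter_subset_right : F₀ ∩ Z ⊆ Z) hZr
    have h2 := rk_mono_fu (M := M) (inter_subset_left (s₁ := F₀) (s₂ := Z))
    omega
  -- `#(F₀ ∖ Z) ≤ 1`
  have h2 : (F₀ \ Z).card ≤ 1 := by
    by_contra hcon
    have hsub : F₀ \ Z ⊆ gr M \ Z := sdiff_subset_sdiff hF.1 (Subset.refl _)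
    have hr : rk M (F₀ \ Z) = (F₀ \ Z).card := rk_eq_card_of_subset_of_rk_eq_card hsub hZcr
    have hle : rk M (F₀ \ Z) ≤ rk M F₀ := rk_mono_fu sdiff_subset
    have hr2 : rk M (F₀ \ Z) = 2 := by omega
    apply hout
    exact (subset_clF_of_rk_le hF.1 sdiff_subset (by rw [hrF, hr2])).trans (clF_mono_fu hsub)
  have := card_sdiff_add_card_inter F₀ Z
  omega

/-- (G) at a rank-two flat with at least four points on any number of points: the sum is empty. -/
theorem sum_sepSets_principal_nonneg_of_four_le_card {F₀ : Finset α} (hF : IsFlatF M F₀) (hrF : rk M F₀ = 2)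
    (hF₀c : 4 ≤ F₀.card) :
    0 ≤ ∑ Z ∈ sepSets M (principalUp M F₀), (2 * (Z.card : ℤ) - (gr M).card - 1) := by
  rw [sepSets_eq_empty_of_four_le_card hF hrF hF₀c, sum_empty]

end PercRepro.Cogirth
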